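import Summits.BirchSwinnertonDyer.BirchSwinnertonDyer.Theorems.GenusKolyvaginAtTwoGenusPrimitiveSupplyAtTwoPrimeHeegnerTwinSilentPrimes
import Summits.BirchSwinnertonDyer.BirchSwinnertonDyer.Theorems.GenusKolyvaginAtTwoGenusPrimitiveSupplyAtTwoTwistingPrime
import Summits.BirchSwinnertonDyer.BirchSwinnertonDyer.Theorems.GenusKolyvaginAtTwoGenusPrimitiveSupplyAtTwoTwistSelmerTransferDownRat
import HarnessLib

/-!
# Route `GenusKolyvaginAtTwo`, crux #2 `GenusPrimitiveSupplyAtTwo` (stmt-BirchSwinnertonDyer-22136):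
# SUPPLY″ (the DEF = 1 Sel₂-minimal twin beyond every bound) with `cor34i_singleton_rat` REPLACED by Poitou–Tate duality
# and Tate's local Euler characteristic

Width seat `bsd-line-gk2-p5` g8 (cell `bsd-f1-sign2`, SUPPLY lineage), thirteenth file of the series (crux workfile
`Lines/genus-supply-mr-instantiation.md` v1.1). THEOREMS ONLY (no definition, no named fact, no `sorry`); helper
`--supports stmt-BirchSwinnertonDyer-22136`; no item is closed; BSD is not proved by any of this.

WHAT. The cell's SUPPLY″ theorems `GenusKolyTwin.supply_DEF1_of_not_strict_prime` (row 1 from one non-strict twisting prime),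
`GenusKolyTwistingPrime.supply_DEF1_minimalTwin_rowOne_of_cor34i` (row 1 beyond every bound) and the habitat statements
`GenusKolyTwin.supply_DEF1_minimalTwin` / `…_habitat` take `h34 : MazurRubin2010.cor34i_singleton_rat` and use only its DOWN half
(`#Sel₂(W) = 4`, `Sel₂(W)` not strict at `ℓ` ⟹ `#Sel₂(W^{(−ℓ)}) = 2`). Here all four are re-derived — statements and proofs VERBATIM —
with `h34` replaced by the displayed print facts `hPT : poitouTate_selmerStructure_duality_real ℚ` (Milne I.4.10) and
`hEP : ∀ v, localEulerPoincareCharacteristic ℚ_v` (Milne I.2.8), through this seat's kernel DOWN theorem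
`GenusKolyTwistLocal.natCard_selmerGroup_eq_two_mul_of_not_le_strictLocalKer` (p624297). The other named facts of the habitat
statement (`prop33_rat` on `#Sel₂ = 1`, T-A, T-V on `Δ > 0`) are untouched.

References: [MazurRubin2010] Prop. 3.3, Cor. 3.4 (i), Prop. 5.3; [MilneADT2006] I Thm. 2.8, I Thm. 4.10; [Kramer1981] Prop. 6;
[GrossLMS1991] §1.
-/

set_option linter.dupNamespace false -- tree convention: `Summit.BirchSwinnertonDyer.BirchSwinnertonDyer.Theorems` (summit = sub-problem)
set_option autoImplicit false

noncomputable section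

open scoped Classical Pointwise

open NumberField WeierstrassCurve IsDedekindDomain
open Literature.NumberTheory.EllipticCurves Literature.NumberTheory.QuadraticFields
open Literature.NumberTheory.GaloisRepresentations Literature.NumberTheory.GaloisCohomology Literature.NumberTheory
open Summit.BirchSwinnertonDyer.Rank1Residual.F1Sign2

/-! ## §30 Row 1 from ONE non-strict twisting prime, modulo {PT, Tate χ} -/

namespace Summit.BirchSwinnertonDyer.BirchSwinnertonDyer.Theorems.GenusKolyTwin

variable (W : WeierstrassCurve ℚ) [W.IsElliptic] [W.IsGloballyMinimal]

/-- **SUPPLY″-Selmer on the `#Sel₂(E) = 4` cells (WALL row 1) from ONE displayed twisting prime** (mod the displayed PRINT facts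
`hPT`, `hEP` — Poitou–Tate duality for Selmer structures, Tate's local Euler characteristic — NOT `cor34i_singleton_rat`; this is
the `cor34i` version with that hypothesis replaced, via gk2-p5's kernel DOWN theorem p624297). Let `W/ℚ` be globally minimal elliptic with `Δ_W < 0` and `#Sel₂(W) = 4`, and let `ℓ` be a
prime with `ℓ ≡ 7 (mod 8)`, `ℓ ≡ −1 (mod p)` for every odd prime `p ∣ N_W`, at which `Sel₂(W)` is NOT strict
(`¬ Sel₂(W) ≤ ker loc_ℓ`, Mazur–Rubin's `V_{{ℓ}} ≠ 0`). Then `K = ℚ(√−ℓ)` carries every K-clause of crux 22136, `2` splits,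
DEF(W,K) = 1 (the `2`-division cubic has exactly one root mod `ℓ`), and the twist has a GLOBALLY MINIMAL model `Wd ≅ W^{(−ℓ)}` with
`#Sel₂(Wd) = 2`. The existence of such an `ℓ` (Mazur–Rubin 2010 §3, Čebotarev) is the one input not supplied here.
[cite: MazurRubin2010, Cor. 3.4 (i) with Def. 3.1] [cite: GrossLMS1991, §1 (p. 235)] -/
theorem supply_DEF1_of_not_strict_prime_of_duality (hPT : poitouTate_selmerStructure_duality_real ℚ)
    (hEP : ∀ v : IsDedekindDomain.HeightOneSpectrum (𝓞 ℚ), localEulerPoincareCharacteristic (v.adicCompletion ℚ)) (hΔ : W.Δ < 0)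
    (h4 : Nat.card (W.selmerGroup 2) = 4) {ℓ : ℕ} [Fact ℓ.Prime] (hℓ8 : ℓ % 8 = 7)
    (hℓN : ∀ p : ℕ, p.Prime → p ∣ W.conductorNorm ℤ → p ≠ 2 → (ℓ : ZMod p) = -1)
    (hns : ¬ W.selmerGroup 2 ≤ MazurRubin2010.strictLocalKer W ℚ_[ℓ] 2) :
    ∃ (K : Type) (_ : Field K) (_ : NumberField K), IsImaginaryQuadratic K ∧ discr K = -(ℓ : ℤ) ∧ Odd (discr K) ∧
      discr K ≠ -3 ∧ SatisfiesHeegnerHypothesis (W.conductorNorm ℤ) K ∧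
      ¬ IsSquare ((discr K : ℚ) * -|W.Δ|) ∧ ¬ IsSquare ((discr K : ℚ) * (-(2 * |W.Δ|))) ∧
      ((Ideal.span {(2 : ℤ)}).primesOver (𝓞 K)).ncard = 2 ∧
      (∃! x : ZMod ℓ, 4 * x ^ 3 + ((integralModelInt W).b₂ : ZMod ℓ) * x ^ 2 +
        2 * ((integralModelInt W).b₄ : ZMod ℓ) * x + ((integralModelInt W).b₆ : ZMod ℓ) = 0) ∧
      ∃ (Wd : WeierstrassCurve ℚ) (_ : Wd.IsElliptic) (_ : Wd.IsGloballyMinimal),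
        (∃ C : VariableChange ℚ, C • W.quadraticTwist (discr K : ℚ) = Wd) ∧ Nat.card (Wd.selmerGroup 2) = 2 := by
  have hℓ : ℓ.Prime := Fact.out
  obtain ⟨-, -, K, _, _, hK, hd, hodd, hd3, hH, h2K, hsq1, hsq2⟩ := exists_heegnerField_of_prime W hℓ hℓ8 hℓN
  -- a globally minimal model of the twist
  have hd0 : ((discr K : ℤ) : ℚ) ≠ 0 := by exact_mod_cast NumberField.discr_ne_zero K
  haveI := W.isElliptic_quadraticTwist hd0
  obtain ⟨C, hC⟩ := hasGlobalMinimalModel_rat_holds (W.quadraticTwist ((discr K : ℤ) : ℚ))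
  haveI := hC
  refine ⟨K, inferInstance, inferInstance, hK, hd, hodd, hd3, hH, hsq1, hsq2, h2K,
    existsUnique_zmod_root_of_discr_eq_neg_prime_of_Δ_neg W hK hodd hH hd hΔ,
    C • W.quadraticTwist ((discr K : ℤ) : ℚ), inferInstance, hC, ⟨C, rfl⟩, ?_⟩
  have h := GenusKolyTwistLocal.natCard_selmerGroup_eq_two_mul_of_not_le_strictLocalKer W hPT hEP hΔ hK hodd hH h2K hd
    _ ⟨C, rfl⟩ hns
  rw [h4] at h
  omega


end Summit.BirchSwinnertonDyer.BirchSwinnertonDyer.Theorems.GenusKolyTwin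

/-! ## §31 Row 1 beyond every bound, modulo {PT, Tate χ} (twisting primes PROVED) -/

namespace Summit.BirchSwinnertonDyer.BirchSwinnertonDyer.Theorems.GenusKolyTwistingPrime

open Field

variable (W : WeierstrassCurve ℚ) [W.IsElliptic] [W.IsGloballyMinimal]

/-- **SUPPLY″-Selmer on WALL row 1, beyond every bound, modulo {Poitou–Tate duality, Tate's local Euler characteristic} ONLY (NO `cor34i_singleton_rat`).** For
`W/ℚ` globally minimal elliptic with `Δ(W) < 0`, `ρ̄_{W,2}` onto and `#Sel₂(W) = 4` (= every habitat cell
of WALL row 1, `s_E = 2`), and every bound `b`: there is a prime `ℓ > b` (a twisting prime of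
`exists_twistingPrime_not_selmerGroup_le_strictLocalKer` for `N = N_W`) such that `K = ℚ(√−ℓ)` carries
every K-clause of crux 22136 (imaginary quadratic, `d_K = −ℓ` odd `≠ −3`, Heegner for `N_W`, the two
non-square clauses), `2` splits in `K`, DEF(W,K) `= 1` (exactly one root of the `2`-division cubic mod `ℓ`),
and the twist has a GLOBALLY MINIMAL model `Wd ≅ W^{(−ℓ)}` with `#Sel₂(Wd) = 2` — gk2-p5's
`GenusKolyTwin.supply_DEF1_of_not_strict_prime` (p609xxx, `…PrimeHeegnerTwinRowOne`) fed with the twisting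
prime proved here. The Čebotarev input is a THEOREM; the only named fact left is
`MazurRubin2010.cor34i_singleton_rat` (PRINT). (The twin's analytic rank `1` is the `2`-converse's business
and is not asserted.) BSD is not proved by this. [cite: MazurRubin2010, Cor. 3.4 (i) with Def. 3.1]
[cite: GrossLMS1991, §1 (p. 235)] -/
theorem supply_DEF1_minimalTwin_rowOne_of_duality (hPT : poitouTate_selmerStructure_duality_real ℚ)
    (hEP : ∀ v : IsDedekindDomain.HeightOneSpectrum (𝓞 ℚ), localEulerPoincareCharacteristic (v.adicCompletion ℚ))
    (hΔ : W.Δ < 0) (hsurj : W.HasSurjectiveModNGaloisRep 2) (h4 : Nat.card (W.selmerGroup 2) = 4)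
    (b : ℕ) :
    ∃ (ℓ : ℕ), ℓ.Prime ∧ b < ℓ ∧ ℓ % 8 = 7 ∧ ¬ ℓ ∣ 2 * W.conductorNorm ℤ ∧
      ∃ (K : Type) (_ : Field K) (_ : NumberField K), IsImaginaryQuadratic K ∧ discr K = -(ℓ : ℤ) ∧
        Odd (discr K) ∧ discr K ≠ -3 ∧ SatisfiesHeegnerHypothesis (W.conductorNorm ℤ) K ∧
        ¬ IsSquare ((discr K : ℚ) * -|W.Δ|) ∧ ¬ IsSquare ((discr K : ℚ) * (-(2 * |W.Δ|))) ∧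
        ((Ideal.span {(2 : ℤ)}).primesOver (𝓞 K)).ncard = 2 ∧
        (∃! x : ZMod ℓ, 4 * x ^ 3 + ((integralModelInt W).b₂ : ZMod ℓ) * x ^ 2 +
          2 * ((integralModelInt W).b₄ : ZMod ℓ) * x + ((integralModelInt W).b₆ : ZMod ℓ) = 0) ∧
        ∃ (Wd : WeierstrassCurve ℚ) (_ : Wd.IsElliptic) (_ : Wd.IsGloballyMinimal),
          (∃ C : VariableChange ℚ, C • W.quadraticTwist (discr K : ℚ) = Wd) ∧
          Nat.card (Wd.selmerGroup 2) = 2 := by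
  have hN : W.conductorNorm ℤ ≠ 0 := (W.conductorNorm_pos_holds).ne'
  have hSel : Nat.card (W.selmerGroup 2) ≠ 1 := by rw [h4]; norm_num
  obtain ⟨ℓ, hℓF, hbℓ, hℓN, hℓ8, hℓp, hns⟩ :=
    exists_twistingPrime_not_selmerGroup_le_strictLocalKer W hsurj hΔ hSel hN b
  have hℓ : ℓ.Prime := hℓF.out
  have hℓN' : ∀ p : ℕ, p.Prime → p ∣ W.conductorNorm ℤ → p ≠ 2 → (ℓ : ZMod p) = -1 := by
    intro p _ hp _
    have h : ((ℓ + 1 : ℕ) : ZMod p) = 0 := (ZMod.natCast_eq_zero_iff _ _).mpr (hℓp p hp)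
    rw [Nat.cast_add, Nat.cast_one] at h
    exact eq_neg_of_add_eq_zero_left h
  obtain ⟨K, _, _, hK, hd, hodd, hd3, hH, hsq1, hsq2, h2K, hDEF, Wd, _, _, hWd, hSelWd⟩ :=
    GenusKolyTwin.supply_DEF1_of_not_strict_prime_of_duality W hPT hEP hΔ h4 hℓ8 hℓN' hns
  exact ⟨ℓ, hℓ, hbℓ, hℓ8, hℓN, K, inferInstance, inferInstance, hK, hd, hodd, hd3, hH, hsq1, hsq2, h2K,
    hDEF, Wd, inferInstance, inferInstance, hWd, hSelWd⟩


end Summit.BirchSwinnertonDyer.BirchSwinnertonDyer.Theorems.GenusKolyTwistingPrime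

/-! ## §32 SUPPLY″ on the habitat, modulo {prop33, PT, Tate χ, T-A, T-V} (no `cor34i_singleton_rat`) -/

namespace Summit.BirchSwinnertonDyer.BirchSwinnertonDyer.Theorems.GenusKolyTwin

open Summit.BirchSwinnertonDyer.BirchSwinnertonDyer.Theorems.GenusKolyTwistingPrime (supply_DEF1_minimalTwin_rowOne_of_duality)

variable (W : WeierstrassCurve ℚ) [W.IsElliptic] [W.IsGloballyMinimal]

/-- **SUPPLY″ («MinimalTwinSupplyDEF1») on the habitat cut out by `#Sel₂(E) ∈ {1, 4}` and `ε(E) = +1 on Δ > 0 row 1`,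
modulo print/typed facts BY NAME — as `supply_DEF1_minimalTwin` but with `cor34i_singleton_rat` replaced by {PT, Tate χ}** — `MazurRubin2010.prop33_rat` (Δ<0, `#Sel₂ = 1`: g6),
Poitou–Tate duality + Tate's local Euler characteristic `hPT`, `hEP` (Δ<0, `#Sel₂ = 4`: gk2-p4 g7 twisting primes ∘ gk2-p5 g8 kernel DOWN transfer p624297 — REPLACING `MazurRubin2010.cor34i_singleton_rat`), T-A
`F1Sign2.AdmissibleTwistSelmerShiftAtTwo` (Δ>0, `#Sel₂ = 1`: g7) and T-V `F1Sign2.StrictShaPropagationAtTwo` (Δ>0,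
`#Sel₂ = 4`, `¬ DescentSignNeg`: g7); every Čebotarev / Dirichlet input is PROVED. Statement: for `W/ℚ` globally minimal
elliptic with `ρ̄_{W,2}` onto, rank `0`, `#Sel₂(W) ∈ {1, 4}`, and `¬ F1Sign2.DescentSignNeg W` whenever `Δ_W > 0` and
`#Sel₂(W) = 4`: beyond every bound `b` there is a prime `ℓ ≡ 7 (mod 8)`, `ℓ ∤ N_W`, such that `K = ℚ(√−ℓ)` carries EVERY
K-clause of crux 22136 (imaginary quadratic, `d_K = −ℓ` odd `≠ −3`, Heegner for `N_W`, the two non-square clauses) with `2`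
split, **DEF(W,K) = 1** in root-count currency (the `2`-division cubic has exactly one root mod `ℓ` if `Δ_W < 0`, none if
`Δ_W > 0`), and the twist has a GLOBALLY MINIMAL model `Wd ≅ W^{(−ℓ)}` with `#Sel₂(Wd) = 2`. The twin's analytic rank one is
NOT asserted (rank-one `2`-converse 19220 / GZK, as for stub A). On `{Δ > 0, #Sel₂ = 4, DescentSignNeg}` the conclusion is
FALSE mod T-V (`no_minimalTwin_of_descentSignNeg`). BSD is not proved by any of this.
[cite: MazurRubin2010, Prop. 3.3, Cor. 3.4 (i), Prop. 5.3] [cite: Kramer1981, Prop. 6] [cite: GrossLMS1991, §1 (p. 235)] -/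
theorem supply_DEF1_minimalTwin_of_duality (h33 : MazurRubin2010.prop33_rat)
    (hPT : poitouTate_selmerStructure_duality_real ℚ)
    (hEP : ∀ v : IsDedekindDomain.HeightOneSpectrum (𝓞 ℚ), localEulerPoincareCharacteristic (v.adicCompletion ℚ))
    (hA : AdmissibleTwistSelmerShiftAtTwo) (hV : StrictShaPropagationAtTwo)
    (hsurj : W.HasSurjectiveModNGaloisRep 2) (hr : W.mordellWeilRank = 0)
    (h14 : Nat.card (W.selmerGroup 2) = 1 ∨ Nat.card (W.selmerGroup 2) = 4)
    (hε : 0 < W.Δ → Nat.card (W.selmerGroup 2) = 4 → ¬ DescentSignNeg W) (b : ℕ) :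
    ∃ ℓ : ℕ, b < ℓ ∧ ℓ.Prime ∧ ℓ % 8 = 7 ∧ ¬ ℓ ∣ W.conductorNorm ℤ ∧
      ((W.Δ < 0 ∧ ∃! x : ZMod ℓ, 4 * x ^ 3 + ((integralModelInt W).b₂ : ZMod ℓ) * x ^ 2 +
          2 * ((integralModelInt W).b₄ : ZMod ℓ) * x + ((integralModelInt W).b₆ : ZMod ℓ) = 0) ∨
        (0 < W.Δ ∧ ∀ x : ZMod ℓ, 4 * x ^ 3 + ((integralModelInt W).b₂ : ZMod ℓ) * x ^ 2 +
          2 * ((integralModelInt W).b₄ : ZMod ℓ) * x + ((integralModelInt W).b₆ : ZMod ℓ) ≠ 0)) ∧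
      ∃ (K : Type) (_ : Field K) (_ : NumberField K), IsImaginaryQuadratic K ∧ discr K = -(ℓ : ℤ) ∧ Odd (discr K) ∧
        discr K ≠ -3 ∧ SatisfiesHeegnerHypothesis (W.conductorNorm ℤ) K ∧
        ¬ IsSquare ((discr K : ℚ) * -|W.Δ|) ∧ ¬ IsSquare ((discr K : ℚ) * (-(2 * |W.Δ|))) ∧
        ((Ideal.span {(2 : ℤ)}).primesOver (𝓞 K)).ncard = 2 ∧
        ∃ (Wd : WeierstrassCurve ℚ) (_ : Wd.IsElliptic) (_ : Wd.IsGloballyMinimal),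
          (∃ C : VariableChange ℚ, C • W.quadraticTwist (discr K : ℚ) = Wd) ∧ Nat.card (Wd.selmerGroup 2) = 2 := by
  rcases lt_or_gt_of_ne W.isUnit_Δ.ne_zero with hΔ | hΔ
  · -- `Δ < 0`: prime Heegner fields are transposition fields (DEF = 1 for free)
    rcases h14 with h1 | h4
    · obtain ⟨K, _, _, ℓ, hℓ, hb, hK, hd, hodd, hd3, hH, hsq1, hsq2, h2K, huniq, Wd, _, _, hWd, hSel⟩ :=
        exists_prime_heegnerField_minimalTwin_of_prop33 W h33 hΔ h1 b
      obtain ⟨-, hℓN, -⟩ := prime_discr_facts W hK hodd hH hℓ hd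
      have hℓ8 : ℓ % 8 = 7 := by
        have h8 := (Quadratic.ncard_primesOver_two_eq_two_iff hK.1).mp h2K
        rw [hd] at h8
        omega
      exact ⟨ℓ, hb, hℓ, hℓ8, hℓN, Or.inl ⟨hΔ, huniq⟩, K, inferInstance, inferInstance, hK, hd, hodd, hd3, hH, hsq1, hsq2,
        h2K, Wd, inferInstance, inferInstance, hWd, hSel⟩
    · obtain ⟨ℓ, hℓ, hb, hℓ8, hℓ2N, K, _, _, hK, hd, hodd, hd3, hH, hsq1, hsq2, h2K, huniq, Wd, _, _, hWd, hSel⟩ :=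
        supply_DEF1_minimalTwin_rowOne_of_duality W hPT hEP hΔ hsurj h4 b
      have hℓN : ¬ ℓ ∣ W.conductorNorm ℤ := fun h => hℓ2N (Dvd.dvd.mul_left h 2)
      exact ⟨ℓ, hb, hℓ, hℓ8, hℓN, Or.inl ⟨hΔ, huniq⟩, K, inferInstance, inferInstance, hK, hd, hodd, hd3, hH, hsq1, hsq2,
        h2K, Wd, inferInstance, inferInstance, hWd, hSel⟩
  · -- `Δ > 0`: silent prime Heegner fields (DEF = 1), the sign `ε(W)` on row 1
    rcases h14 with h1 | h4
    · obtain ⟨ℓ, hb, hℓ, hsil, K, _, _, hK, hd, hodd, hd3, hH, hsq1, hsq2, h2K, -, Wd, _, _, hWd, hSel⟩ :=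
        supply_DEF1_posDisc W hA hΔ hsurj h1 b
      obtain ⟨-, hℓN, -⟩ := prime_discr_facts W hK hodd hH hℓ hd
      have hℓ8 : ℓ % 8 = 7 := by
        have h8 := (Quadratic.ncard_primesOver_two_eq_two_iff hK.1).mp h2K
        rw [hd] at h8
        omega
      exact ⟨ℓ, hb, hℓ, hℓ8, hℓN, Or.inr ⟨hΔ, hsil⟩, K, inferInstance, inferInstance, hK, hd, hodd, hd3, hH, hsq1, hsq2,
        h2K, Wd, inferInstance, inferInstance, hWd, hSel⟩
    · obtain ⟨ℓ, hb, hℓ, hsil, K, _, _, hK, hd, hodd, hd3, hH, hsq1, hsq2, h2K, -, Wd, _, _, hWd, hSel⟩ :=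
        supply_DEF1_posDisc_rowOne_of_not_descentSignNeg W hV hΔ hsurj hr h4 (hε hΔ h4) b
      obtain ⟨-, hℓN, -⟩ := prime_discr_facts W hK hodd hH hℓ hd
      have hℓ8 : ℓ % 8 = 7 := by
        have h8 := (Quadratic.ncard_primesOver_two_eq_two_iff hK.1).mp h2K
        rw [hd] at h8
        omega
      exact ⟨ℓ, hb, hℓ, hℓ8, hℓN, Or.inr ⟨hΔ, hsil⟩, K, inferInstance, inferInstance, hK, hd, hodd, hd3, hH, hsq1, hsq2,
        h2K, Wd, inferInstance, inferInstance, hWd, hSel⟩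

/-- **The same under the binders of crux 22136** (`r_an(W) = 0` with the Gross–Zagier–Kolyvagin fact
`rank_eq_analyticRank_of_analyticRank_le_one` = item 19921 BY NAME; `ρ_{W,2^n}` onto for every `n ≥ 1`). -/
theorem supply_DEF1_minimalTwin_habitat_of_duality (h33 : MazurRubin2010.prop33_rat)
    (hPT : poitouTate_selmerStructure_duality_real ℚ)
    (hEP : ∀ v : IsDedekindDomain.HeightOneSpectrum (𝓞 ℚ), localEulerPoincareCharacteristic (v.adicCompletion ℚ))
    (hA : AdmissibleTwistSelmerShiftAtTwo) (hV : StrictShaPropagationAtTwo)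
    (hGZK : rank_eq_analyticRank_of_analyticRank_le_one) (hr0 : W.analyticRank = 0)
    (hρ : ∀ n : ℕ, 0 < n → W.HasSurjectiveModNGaloisRep ((2 : ℤ) ^ n))
    (h14 : Nat.card (W.selmerGroup 2) = 1 ∨ Nat.card (W.selmerGroup 2) = 4)
    (hε : 0 < W.Δ → Nat.card (W.selmerGroup 2) = 4 → ¬ DescentSignNeg W) (b : ℕ) :
    ∃ ℓ : ℕ, b < ℓ ∧ ℓ.Prime ∧ ℓ % 8 = 7 ∧ ¬ ℓ ∣ W.conductorNorm ℤ ∧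
      ((W.Δ < 0 ∧ ∃! x : ZMod ℓ, 4 * x ^ 3 + ((integralModelInt W).b₂ : ZMod ℓ) * x ^ 2 +
          2 * ((integralModelInt W).b₄ : ZMod ℓ) * x + ((integralModelInt W).b₆ : ZMod ℓ) = 0) ∨
        (0 < W.Δ ∧ ∀ x : ZMod ℓ, 4 * x ^ 3 + ((integralModelInt W).b₂ : ZMod ℓ) * x ^ 2 +
          2 * ((integralModelInt W).b₄ : ZMod ℓ) * x + ((integralModelInt W).b₆ : ZMod ℓ) ≠ 0)) ∧
      ∃ (K : Type) (_ : Field K) (_ : NumberField K), IsImaginaryQuadratic K ∧ discr K = -(ℓ : ℤ) ∧ Odd (discr K) ∧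
        discr K ≠ -3 ∧ SatisfiesHeegnerHypothesis (W.conductorNorm ℤ) K ∧
        ¬ IsSquare ((discr K : ℚ) * -|W.Δ|) ∧ ¬ IsSquare ((discr K : ℚ) * (-(2 * |W.Δ|))) ∧
        ((Ideal.span {(2 : ℤ)}).primesOver (𝓞 K)).ncard = 2 ∧
        ∃ (Wd : WeierstrassCurve ℚ) (_ : Wd.IsElliptic) (_ : Wd.IsGloballyMinimal),
          (∃ C : VariableChange ℚ, C • W.quadraticTwist (discr K : ℚ) = Wd) ∧ Nat.card (Wd.selmerGroup 2) = 2 := by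
  have hr : W.mordellWeilRank = 0 := by rw [(hGZK W (by rw [hr0]; exact zero_le_one)).1, hr0]
  exact supply_DEF1_minimalTwin_of_duality W h33 hPT hEP hA hV (by simpa using hρ 1 one_pos) hr h14 hε b

end Summit.BirchSwinnertonDyer.BirchSwinnertonDyer.Theorems.GenusKolyTwin

end
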